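import Literature.MathematicalPhysics.QuantumLattice.HubbardCanonicalGaussianDomination
import Literature.MathematicalPhysics.QuantumLattice.HubbardKuboKishiFSum
import HarnessLib

/-!
# Kubo–Kishi susceptibility bounds in the canonical ensemble (fixed `N↑`, `N↓`)

Bounds for model classes (finite-graph Hubbard Hamiltonians at `T > 0`); no materials claim.

Kubo–Kishi [KuboKishi1990, Thms 1–2, eqs. (3)–(10)] bound the longitudinal spin susceptibility of
the ATTRACTIVE Hubbard model and the charge / on-site-pairing susceptibility of the REPULSIVE
half-filled model on a bipartite lattice in the GRAND-canonical ensemble (reprinted in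
[corpus: book:editornd-hubbard-model, p. 122]: "we work in the grand canonical ensemble"). Their
Gaussian domination `Ξ({h}) ≤ Ξ` is proved by Trotter + Hubbard–Stratonovich + Schwarz between the
up- and down-spin traces, an argument that runs unchanged inside every sector `Ran P_k ⊗ Ran P_l`
of Lieb's spin-split space [LiebPRL1989, eq. (4)]; the tree records that sector form as
`hubbard_attractive_sectorGaussianDomination`
(`Re Tr[P_{k,l} e^{-β(H - M_a + c_a)}] ≤ (Re Tr[P_{k,k} e^{-βH}])^{1/2} (Re Tr[P_{l,l} e^{-βH}])^{1/2}`).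

This file turns the sector form into the CANONICAL susceptibility bounds, i.e. the same
inequalities for the Gibbs state of the compression `H|_{(k,l)}` of the Hamiltonian to a sector
`N↑ = k`, `N↓ = l` (the ensemble used by the finite-lattice stiffness / kinetic-energy ceilings of
the companion cell files):

* the dictionary `Tr[P_{k,l} e^{-βX}] = Z_β(X|_{(k,l)})` for sector-preserving `X`
  (`trace_spinSectorProj_mul_gibbsWeight`; block calculus `toBlock_*_of_offBlock_eq_zero`);
* ATTRACTIVE `U < 0`, `S^z = 0` sectors `(k,k)`, any `μ`:
  `Z_β((H - τM_a + τ²Σa²/(2|U|))|_{(k,k)}) ≤ Z_β(H|_{(k,k)})`, hence by the tree's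
  Dyson–Lieb–Simon lemma [DLS1978, (44)] `(M_a, M_a)_{β,(k,k)} ≤ Σₓaₓ²/(β|U|)` and the Falk–Bruch
  transfer to `⟨M_a²⟩_{β,(k,k)}` (Kubo–Kishi (10), (3), (4) canonically);
* REPULSIVE `U > 0` on a bipartite graph, HALF-FILLED sectors `k + l = |Λ|` (every `S^z`):
  Lieb's partial particle–hole map `S` (gauged Shiba transformation) sends `P_{k,l} ↦ P_{k,|Λ|-l}`
  (`shibaKK_conj_spinSectorProj`), `H(t,U) ↦ H(t,-U) + U N↑`, `D_a ↦ M_a`, and `U N↑ = Uk` on the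
  image sector `(k,k)`; so `Z_β((H - τD_a + τ²Σa²/(2U))|_{(k,l)}) ≤ Z_β(H|_{(k,l)})`,
  `(D_a, D_a)_{β,(k,l)} ≤ Σₓaₓ²/(βU)` and the Falk–Bruch transfer (Kubo–Kishi (5), Remark 3
  canonically; off half filling the map leaves the half-filled sectors and no bound is claimed);
* the block `f`-sum identities `[M_a,[H,M_a]]|_p = [D_a,[H,D_a]]|_p = (t·T((aₓ-a_y)²))|_p`
  (Kubo–Kishi Remark 1), which let the cell files evaluate the Falk–Bruch double commutator by
  their sector kinetic-energy ceilings instead of the operator norm.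

All statements are finite-dimensional matrix inequalities, proved here (no named facts added).
-/

noncomputable section

namespace Literature.MathematicalPhysics.QuantumLattice

open Matrix Finset HubbardWave0 LiebThm1
open scoped symmDiff ComplexOrder

/-! ### Block calculus for matrices with no entries from a block to its complement -/

section BlockGeneric

variable {ι : Type*} [Fintype ι] [DecidableEq ι]

omit [DecidableEq ι] in
/-- A sum of a function vanishing off `p` is a sum over the subtype of `p`. [folklore] -/
private theorem sum_eq_sum_subtype_of_support'' (p : ι → Prop) [DecidablePred p] (f : ι → ℂ)
    (hf : ∀ i, ¬ p i → f i = 0) : ∑ i, f i = ∑ a : Subtype p, f a.1 := by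
  rw [← Finset.sum_subtype (Finset.univ.filter p) (by simp), Finset.sum_filter_of_ne]
  intro i _ hi
  by_contra h
  exact hi (hf i h)

omit [DecidableEq ι] in
/-- `(A B)_p = A_p B_p` when `A` has no entries from the block `p` to its complement. [folklore] -/
private theorem toBlock_mul_of_offBlock_eq_zero (A B : Matrix ι ι ℂ) (p : ι → Prop) [DecidablePred p]
    (hA : A.toBlock p (fun a => ¬ p a) = 0) :
    (A * B).toBlock p p = A.toBlock p p * B.toBlock p p := by
  rw [toBlock_mul_eq_add p p p A B, hA, Matrix.zero_mul, add_zero]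

omit [Fintype ι] [DecidableEq ι] in
/-- `(A + B)_p = A_p + B_p`. [folklore] -/
private theorem toBlock_add_self' (A B : Matrix ι ι ℂ) (p : ι → Prop) :
    (A + B).toBlock p p = A.toBlock p p + B.toBlock p p := rfl

omit [Fintype ι] [DecidableEq ι] in
/-- `(A - B)_p = A_p - B_p`. [folklore] -/
private theorem toBlock_sub_self' (A B : Matrix ι ι ℂ) (p : ι → Prop) :
    (A - B).toBlock p p = A.toBlock p p - B.toBlock p p := rfl

omit [Fintype ι] [DecidableEq ι] in
/-- `(c A)_p = c A_p`. [folklore] -/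
private theorem toBlock_smul_self' (c : ℂ) (A : Matrix ι ι ℂ) (p : ι → Prop) :
    (c • A).toBlock p p = c • A.toBlock p p := rfl

omit [Fintype ι] in
/-- `(H - uM + c·1)_p = H_p - uM_p + c·1`. [folklore] -/
private theorem toBlock_sub_smul_add_smul_one (H M : Matrix ι ι ℂ) (u c : ℂ) (p : ι → Prop)
    [DecidablePred p] :
    (H - u • M + c • (1 : Matrix ι ι ℂ)).toBlock p p = H.toBlock p p - u • M.toBlock p p + c • 1 := by
  rw [← toBlock_one_self p]
  rfl

omit [Fintype ι] in
/-- A diagonal matrix which is constant on the block `p` compresses to a scalar. [folklore] -/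
private theorem toBlock_diagonal_of_const {d : ι → ℂ} (p : ι → Prop) [DecidablePred p] {r : ℂ}
    (hd : ∀ i, p i → d i = r) :
    (diagonal d).toBlock p p = r • (1 : Matrix {a // p a} {a // p a} ℂ) := by
  rw [toBlock_diagonal_self]
  ext i j
  by_cases h : i = j
  · rw [h]
    simp [hd j.1 j.2]
  · simp [h]

/-- Powers of a matrix with no entries from the block `p` to its complement compress to powers of
the compression: `(A^k)_p = (A_p)^k`. [folklore] -/
private theorem toBlock_pow_of_offBlock_eq_zero (A : Matrix ι ι ℂ) (p : ι → Prop) [DecidablePred p]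
    (hA : A.toBlock p (fun a => ¬ p a) = 0) (k : ℕ) :
    (A ^ k).toBlock p p = (A.toBlock p p) ^ k := by
  induction k with
  | zero => rw [pow_zero, pow_zero, toBlock_one_self]
  | succ k ih => rw [pow_succ', toBlock_mul_eq_add p p p A (A ^ k), hA, Matrix.zero_mul, add_zero,
      ih, pow_succ']

open NormedSpace in
open scoped Matrix.Norms.Operator in
/-- The exponential of a matrix with no entries from the block `p` to its complement compresses to
the exponential of the compression: `(e^{A})_p = e^{A_p}` (the exponential series term by term).
[folklore] -/
private theorem toBlock_exp_of_offBlock_eq_zero (A : Matrix ι ι ℂ) (p : ι → Prop) [DecidablePred p]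
    (hA : A.toBlock p (fun a => ¬ p a) = 0) :
    (exp A).toBlock p p = exp (A.toBlock p p) := by
  have hs := exp_series_hasSum_exp' (𝕂 := ℂ) A
  let g : Matrix ι ι ℂ →+ Matrix {a // p a} {a // p a} ℂ :=
    { toFun := fun X => X.toBlock p p, map_zero' := rfl, map_add' := fun _ _ => rfl }
  have hg : Continuous g := continuous_id.matrix_submatrix _ _
  have h1 : HasSum (fun k => ((k.factorial : ℂ)⁻¹ • A ^ k).toBlock p p) ((exp A).toBlock p p) :=
    hs.map g hg
  have h2 := exp_series_hasSum_exp' (𝕂 := ℂ) (A.toBlock p p)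
  have heq : (fun k => ((k.factorial : ℂ)⁻¹ • A ^ k).toBlock p p) =
      fun k => (k.factorial : ℂ)⁻¹ • (A.toBlock p p) ^ k := by
    funext k
    rw [← toBlock_pow_of_offBlock_eq_zero A p hA k]
    rfl
  rw [heq] at h1
  exact h1.unique h2

/-- The Gibbs weight of a matrix with no entries from the block `p` to its complement compresses to
the Gibbs weight of the compression: `(e^{-βH})_p = e^{-βH_p}`. [folklore] -/
private theorem toBlock_gibbsWeight_of_offBlock_eq_zero (β : ℝ) (H : Matrix ι ι ℂ) (p : ι → Prop)
    [DecidablePred p] (hH : H.toBlock p (fun a => ¬ p a) = 0) :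
    (gibbsWeight β H).toBlock p p = gibbsWeight β (H.toBlock p p) := by
  have hs : (-(β : ℂ) • H).toBlock p (fun a => ¬ p a) = 0 := by
    ext a b
    have h := congrFun (congrFun hH a) b
    simp only [toBlock_apply, Matrix.zero_apply] at h
    simp only [toBlock_apply, Matrix.smul_apply, h, smul_zero, Matrix.zero_apply]
  rw [gibbsWeight, gibbsWeight, toBlock_exp_of_offBlock_eq_zero _ p hs]
  rfl

/-- `tr (diag 𝟙_p · X) = tr X_p`: the trace against the coordinate projection of the block is the
trace of the compression. [folklore] -/
private theorem trace_indicator_mul_eq_trace_toBlock' (p : ι → Prop) [DecidablePred p] (X : Matrix ι ι ℂ) :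
    (diagonal (fun a => if p a then (1 : ℂ) else 0) * X).trace = (X.toBlock p p).trace := by
  simp only [Matrix.trace, Matrix.diag_apply, diagonal_mul, toBlock_apply]
  rw [sum_eq_sum_subtype_of_support'' p (fun a => (if p a then (1 : ℂ) else 0) * X a a)
    fun a ha => by rw [if_neg ha, zero_mul]]
  exact Finset.sum_congr rfl fun a _ => by rw [if_pos a.2, one_mul]

/-- `e^{-β S X Sᴴ} = S e^{-βX} Sᴴ` for unitary `S`. [folklore] -/
private theorem gibbsWeight_unitary_conj {S : Matrix ι ι ℂ} (hS : S ∈ Matrix.unitaryGroup ι ℂ) (β : ℝ)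
    (X : Matrix ι ι ℂ) : gibbsWeight β (S * X * Sᴴ) = S * gibbsWeight β X * Sᴴ := by
  have hunit : IsUnit S := ⟨Unitary.toUnits ⟨S, hS⟩, rfl⟩
  have hinv : S⁻¹ = Sᴴ := by
    rw [Matrix.inv_eq_right_inv (Unitary.mul_star_self_of_mem hS)]
    rfl
  rw [gibbsWeight, gibbsWeight, ← hinv, show -(β : ℂ) • (S * X * S⁻¹) = S * (-(β : ℂ) • X) * S⁻¹ by
    rw [Matrix.mul_smul, Matrix.smul_mul], Matrix.exp_conj _ _ hunit]

/-- `tr[(S P Sᴴ)(S W Sᴴ)] = tr[P W]` for unitary `S`. [folklore] -/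
private theorem trace_unitary_conj_mul_unitary_conj {S : Matrix ι ι ℂ} (hS : S ∈ Matrix.unitaryGroup ι ℂ)
    (P W : Matrix ι ι ℂ) : (S * P * Sᴴ * (S * W * Sᴴ)).trace = (P * W).trace := by
  have h1 : Sᴴ * S = 1 := Unitary.star_mul_self_of_mem hS
  rw [show S * P * Sᴴ * (S * W * Sᴴ) = S * (P * W) * Sᴴ by
    rw [← Matrix.mul_assoc, ← Matrix.mul_assoc, Matrix.mul_assoc (S * P), h1, Matrix.mul_one,
      Matrix.mul_assoc S P W], trace_mul_cycle, h1, Matrix.one_mul]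

end BlockGeneric

/-! ### Sectors `(N↑, N↓) = (k, l)`: block bookkeeping -/

section SectorBlocks

variable {Λ : Type*} [LinearOrder Λ] [Fintype Λ]

/-- Differences of sector-preserving matrices preserve sectors. [folklore] -/
private theorem preservesSectors_sub {M N : Matrix (Finset (Orb Λ)) (Finset (Orb Λ)) ℂ}
    (hM : PreservesSectors M) (hN : PreservesSectors N) : PreservesSectors (M - N) := by
  rw [sub_eq_add_neg, ← neg_one_smul ℂ N]
  exact hM.add (hN.smul _)

/-- The identity matrix preserves sectors. [folklore] -/
private theorem preservesSectors_one' : PreservesSectors (1 : Matrix (Finset (Orb Λ)) (Finset (Orb Λ)) ℂ) := by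
  rw [← Matrix.diagonal_one]
  exact PreservesSectors.diagonal _

/-- `N = Σ_{x,σ} n_{xσ}` preserves sectors. [folklore] -/
private theorem preservesSectors_totalNumber :
    PreservesSectors (totalNumber : Matrix (Finset (Orb Λ)) (Finset (Orb Λ)) ℂ) := by
  rw [totalNumber]
  exact PreservesSectors.sum fun x _ => PreservesSectors.sum fun σ _ => preservesSectors_numberOp x σ

/-- `M_a = Σ aₓ(n_{x↑} - n_{x↓})` preserves sectors. [cite: KuboKishi1990, eq. (7)] -/
theorem preservesSectors_spinDensityField (a : Λ → ℝ) : PreservesSectors (spinDensityField a) := by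
  unfold spinDensityField
  exact PreservesSectors.sum fun x _ =>
    (preservesSectors_sub (preservesSectors_numberOp x 0) (preservesSectors_numberOp x 1)).smul _

/-- `D_a = Σ aₓ(nₓ - 1)` preserves sectors. [cite: KuboKishi1990, Theorem 2] -/
theorem preservesSectors_chargeDensityField (a : Λ → ℝ) : PreservesSectors (chargeDensityField a) := by
  unfold chargeDensityField
  exact PreservesSectors.sum fun x _ =>
    (preservesSectors_sub ((preservesSectors_numberOp x 0).add (preservesSectors_numberOp x 1))
      preservesSectors_one').smul _

variable (G : SimpleGraph Λ) [DecidableRel G.Adj] in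
/-- `H(t,U) - μN` preserves sectors (`N↑`, `N↓` are conserved). [cite: LiebPRL1989, proof of Theorem 1] -/
theorem preservesSectors_hamiltonianWith (t U μ : ℝ) : PreservesSectors (hamiltonianWith G t U μ) := by
  rw [hamiltonianWith]
  exact preservesSectors_sub (preservesSectors_hamiltonian G t U) (preservesSectors_totalNumber.smul _)

/-- A sector-preserving matrix has no entries from the sector `(k,l)` to its complement, for any
decidable presentation `p` of the sector. [cite: LiebPRL1989, proof of Theorem 1] -/
theorem toBlock_compl_eq_zero_of_preservesSectors {M : Matrix (Finset (Orb Λ)) (Finset (Orb Λ)) ℂ}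
    (hM : PreservesSectors M) {k l : ℕ} (p : Finset (Orb Λ) → Prop) [DecidablePred p]
    (hp : ∀ s, p s ↔ (upPart s).card = k ∧ (downPart s).card = l) :
    M.toBlock p (fun s => ¬ p s) = 0 := by
  ext a b
  rw [toBlock_apply, Matrix.zero_apply]
  by_contra h
  have h1 := hM a.1 b.1 h
  have ha := (hp a.1).1 a.2
  exact b.2 ((hp b.1).2 ⟨h1.1.symm.trans ha.1, h1.2.symm.trans ha.2⟩)

/-- `P_{k,l}` is the coordinate indicator of any decidable presentation `p` of the sector.
[cite: LiebPRL1989, proof of Theorem 1] -/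
theorem spinSectorProj_eq_indicator {k l : ℕ} (p : Finset (Orb Λ) → Prop) [DecidablePred p]
    (hp : ∀ s, p s ↔ (upPart s).card = k ∧ (downPart s).card = l) :
    (spinSectorProj k l : Matrix (Finset (Orb Λ)) (Finset (Orb Λ)) ℂ) =
      diagonal fun s => if p s then 1 else 0 := by
  rw [spinSectorProj]
  congr 1
  funext s
  by_cases h : p s
  · rw [if_pos h, if_pos ((hp s).1 h)]
  · rw [if_neg h, if_neg fun h' => h ((hp s).2 h')]

/-- **The dictionary `Tr[P_{k,l} e^{-βX}] = Z_β(X|_{(k,l)})`** for a sector-preserving `X`: the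
sector-projected partition function is the partition function of the compression of `X` to the
sector (canonical ensemble with `N↑ = k`, `N↓ = l`). [cite: LiebPRL1989, proof of Theorem 1] -/
theorem trace_spinSectorProj_mul_gibbsWeight {X : Matrix (Finset (Orb Λ)) (Finset (Orb Λ)) ℂ}
    (hX : PreservesSectors X) (β : ℝ) {k l : ℕ} (p : Finset (Orb Λ) → Prop) [DecidablePred p]
    (hp : ∀ s, p s ↔ (upPart s).card = k ∧ (downPart s).card = l) :
    (spinSectorProj k l * gibbsWeight β X).trace = partitionFn β (X.toBlock p p) := by
  rw [spinSectorProj_eq_indicator p hp, trace_indicator_mul_eq_trace_toBlock', partitionFn,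
    toBlock_gibbsWeight_of_offBlock_eq_zero β X p (toBlock_compl_eq_zero_of_preservesSectors hX p hp)]

/-! ### The partial particle–hole map on the sectors: `S P_{k,l} Sᴴ = P_{k,|Λ|-l}` -/

/-- Conjugating a diagonal matrix by the partial particle–hole transformation on `D` relabels it
by `s ↦ s ∆ D`. [cite: LiebPRL1989, proof of Theorem 2] -/
theorem partialParticleHole_conj_diagonal (D : Finset (Orb Λ)) (d : Finset (Orb Λ) → ℂ) :
    partialParticleHole D * diagonal d * (partialParticleHole D)ᴴ = diagonal fun t => d (t ∆ D) := by
  apply matrix_eq_of_mulVec_eq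
  intro ψ
  funext t
  simp only [← mulVec_mulVec, partialParticleHole_mulVec_apply, mulVec_diagonal,
    partialParticleHole_conjTranspose_mulVec_apply, symmDiff_symmDiff_self']
  linear_combination (d (t ∆ D) * ψ t) * phWeight_mul_self D (t ∆ D)

/-- Conjugating a diagonal matrix by a diagonal gauge `orbitalPhase g`, `|g| = 1`, does nothing.
[folklore] -/
private theorem orbitalPhase_conj_diagonal {g : Orb Λ → ℂ} (hg : ∀ i, ‖g i‖ = 1) (d : Finset (Orb Λ) → ℂ) :
    orbitalPhase g * diagonal d * (orbitalPhase g)ᴴ = diagonal d := by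
  have hc : orbitalPhase g * diagonal d = diagonal d * orbitalPhase g := by
    rw [orbitalPhase, diagonal_mul_diagonal, diagonal_mul_diagonal]
    congr 1
    funext s
    ring
  rw [hc, Matrix.mul_assoc, orbitalPhase_mul_conjTranspose hg, Matrix.mul_one]

/-- `s ↦ s ∆ D↓` does not touch the up electrons. [folklore] -/
private theorem upPart_symmDiff_spinDownOrbitals (s : Finset (Orb Λ)) :
    upPart (s ∆ (spinDownOrbitals : Finset (Orb Λ))) = upPart s := by
  ext x
  simp [Finset.mem_symmDiff]

/-- `s ↦ s ∆ D↓` complements the down electrons. [folklore] -/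
private theorem downPart_symmDiff_spinDownOrbitals (s : Finset (Orb Λ)) :
    downPart (s ∆ (spinDownOrbitals : Finset (Orb Λ))) = univ \ downPart s := by
  ext x
  simp [Finset.mem_symmDiff]

/-- **The gauged partial particle–hole map sends the sector `(k,l)` to `(k, |Λ|-l)`**:
`S P_{k,l} Sᴴ = P_{k,|Λ|-l}` for `S = orbitalPhase g · W_{D↓}`, `|g| = 1`, `l ≤ |Λ|` (Lieb's
`c_{x↓} ↦ c†_{x↓}`: `N↓ ↦ |Λ| - N↓`, `N↑ ↦ N↑`). [cite: LiebPRL1989, proof of Theorem 2] -/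
theorem shibaKK_conj_spinSectorProj {g : Orb Λ → ℂ} (hg : ∀ i, ‖g i‖ = 1) {k l : ℕ}
    (hl : l ≤ Fintype.card Λ) :
    orbitalPhase g * partialParticleHole (spinDownOrbitals : Finset (Orb Λ)) * spinSectorProj k l *
        (orbitalPhase g * partialParticleHole (spinDownOrbitals : Finset (Orb Λ)))ᴴ =
      spinSectorProj k (Fintype.card Λ - l) := by
  rw [conjTranspose_mul, spinSectorProj, spinSectorProj,
    show orbitalPhase g * partialParticleHole (spinDownOrbitals : Finset (Orb Λ)) *
        diagonal (fun s => if (upPart s).card = k ∧ (downPart s).card = l then (1 : ℂ) else 0) *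
        ((partialParticleHole (spinDownOrbitals : Finset (Orb Λ)))ᴴ * (orbitalPhase g)ᴴ) =
      orbitalPhase g * (partialParticleHole (spinDownOrbitals : Finset (Orb Λ)) *
        diagonal (fun s => if (upPart s).card = k ∧ (downPart s).card = l then (1 : ℂ) else 0) *
        (partialParticleHole (spinDownOrbitals : Finset (Orb Λ)))ᴴ) * (orbitalPhase g)ᴴ by
      simp only [Matrix.mul_assoc], partialParticleHole_conj_diagonal, orbitalPhase_conj_diagonal hg]
  congr 1
  funext s
  rw [upPart_symmDiff_spinDownOrbitals, downPart_symmDiff_spinDownOrbitals, Finset.card_univ_sdiff]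
  have hc := Finset.card_le_univ (downPart s)
  have h : (Fintype.card Λ - (downPart s).card = l) ↔ ((downPart s).card = Fintype.card Λ - l) := by
    omega
  simp only [h]

end SectorBlocks

/-! ### The canonical bounds -/

section Canonical

variable {Λ : Type} [LinearOrder Λ] [Fintype Λ] (G : SimpleGraph Λ) [DecidableRel G.Adj]

omit [LinearOrder Λ] [DecidableRel G.Adj] in
/-- `Σ_x (τ a_x)² = τ² Σ_x a_x²` (plumbing). [folklore] -/
private theorem sum_sq_mul' (τ : ℝ) (a : Λ → ℝ) : (∑ x, (τ * a x) ^ 2) = τ ^ 2 * ∑ x, a x ^ 2 := by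
  rw [Finset.mul_sum]
  exact sum_congr rfl fun x _ => by ring

omit [DecidableRel G.Adj] in
/-- `M_{τa} = τ M_a` (plumbing). [folklore] -/
private theorem spinDensityField_smul' (τ : ℝ) (a : Λ → ℝ) :
    spinDensityField (fun x => τ * a x) = (τ : ℂ) • spinDensityField a := by
  unfold spinDensityField
  rw [Finset.smul_sum]
  refine sum_congr rfl fun x _ => ?_
  rw [Complex.ofReal_mul, mul_smul]

omit [DecidableRel G.Adj] in
/-- `D_{τa} = τ D_a` (plumbing). [folklore] -/
private theorem chargeDensityField_smul' (τ : ℝ) (a : Λ → ℝ) :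
    chargeDensityField (fun x => τ * a x) = (τ : ℂ) • chargeDensityField a := by
  unfold chargeDensityField
  rw [Finset.smul_sum]
  refine sum_congr rfl fun x _ => ?_
  rw [Complex.ofReal_mul, mul_smul]

/-! #### Attractive `U < 0`: the `S^z = 0` sectors `(k,k)` -/

/-- **Kubo–Kishi's Gaussian domination in the canonical `S^z = 0` ensemble of the attractive
Hubbard model (block form).** For `U < 0`, any `μ`, `β > 0`, every real field `a` and every sector
`N↑ = N↓ = k` (presented by any decidable `p`):
`Re Z_β((H - M_a + (Σₓaₓ²/(2|U|))·1)|_p) ≤ Re Z_β(H|_p)`, `H = H(t,U) - μN`,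
`M_a = Σₓ aₓ(n_{x↑} - n_{x↓})` — the tree's sector Gaussian domination
`hubbard_attractive_sectorGaussianDomination` with `k = l` (so that `√Z_{k,k} √Z_{k,k} = Z_{k,k}`),
read through the dictionary `Tr[P e^{-βX}] = Z(X|_p)`.
[cite: KuboKishi1990, proof of Theorem 1, eqs. (7)–(9)] [cite: LiebPRL1989, eq. (4)] -/
theorem hubbard_attractive_sector_blockGaussianDomination {t U μ β : ℝ} (hU : U < 0) (hβ : 0 < β)
    (a : Λ → ℝ) {k : ℕ} (p : Finset (Orb Λ) → Prop) [DecidablePred p]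
    (hp : ∀ s, p s ↔ (upPart s).card = k ∧ (downPart s).card = k) :
    (partitionFn β ((hamiltonianWith G t U μ - spinDensityField a +
        (((∑ x, a x ^ 2) / (2 * |U|) : ℝ) : ℂ) •
          (1 : Matrix (Finset (Orb Λ)) (Finset (Orb Λ)) ℂ)).toBlock p p)).re ≤
      (partitionFn β ((hamiltonianWith G t U μ).toBlock p p)).re := by
  have hH := preservesSectors_hamiltonianWith G t U μ
  have hX : PreservesSectors (hamiltonianWith G t U μ - spinDensityField a +
      (((∑ x, a x ^ 2) / (2 * |U|) : ℝ) : ℂ) • (1 : Matrix (Finset (Orb Λ)) (Finset (Orb Λ)) ℂ)) :=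
    (preservesSectors_sub hH (preservesSectors_spinDensityField a)).add (preservesSectors_one'.smul _)
  rw [← trace_spinSectorProj_mul_gibbsWeight hX β p hp, ← trace_spinSectorProj_mul_gibbsWeight hH β p hp]
  have h := hubbard_attractive_sectorGaussianDomination G t U μ β hU hβ a k k
  have hnn : 0 ≤ ((spinSectorProj k k * gibbsWeight β (hamiltonianWith G t U μ)).trace).re :=
    Literature.LinearAlgebra.Matrix.re_trace_mul_nonneg_of_posSemidef (posSemidef_spinSectorProj k k)
      (posDef_gibbsWeight β (isHermitian_hamiltonianWith G t U μ)).posSemidef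
  rwa [Real.mul_self_sqrt hnn] at h

/-- **Kubo–Kishi (10)/(3) in the canonical `S^z = 0` ensemble (attractive model).** For `U < 0`,
any `μ`, `β > 0`, every real `a` and every non-empty sector `N↑ = N↓ = k`:
`(M_a|_p, M_a|_p)_{β, H|_p} ≤ Σₓ aₓ²/(β|U|)` for the Duhamel two-point function of the sector
Gibbs state — Dyson–Lieb–Simon's lemma (`Matrix.gaussianDomination_duhamel_le`, proved in the tree)
fed with the block Gaussian domination along `τ ↦ M_{τa}`.
[cite: KuboKishi1990, Theorem 1, eqs. (3), (10)] [cite: DLS1978, Lemma 4.1, eq. (44)] -/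
theorem hubbard_attractive_sector_duhamel_le {t U μ β : ℝ} (hU : U < 0) (hβ : 0 < β) (a : Λ → ℝ)
    {k : ℕ} (p : Finset (Orb Λ) → Prop) [DecidablePred p]
    (hp : ∀ s, p s ↔ (upPart s).card = k ∧ (downPart s).card = k) [Nonempty {s // p s}] :
    (duhamel β ((hamiltonianWith G t U μ).toBlock p p) ((spinDensityField a).toBlock p p)
        ((spinDensityField a).toBlock p p)).re ≤ (∑ x, a x ^ 2) / |U| / β := by
  refine gaussianDomination_duhamel_le_holds {s // p s} β hβ _ _
    ((isHermitian_hamiltonianWith G t U μ).submatrix _) ((isHermitian_spinDensityField a).submatrix _)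
    _ fun τ => ?_
  have h := hubbard_attractive_sector_blockGaussianDomination G (t := t) (μ := μ) hU hβ
    (fun x => τ * a x) p hp
  have hc : (∑ x, (τ * a x) ^ 2) / (2 * |U|) = τ ^ 2 * ((∑ x, a x ^ 2) / |U|) / 2 := by
    rw [sum_sq_mul']; ring
  rw [spinDensityField_smul', hc, toBlock_sub_smul_add_smul_one] at h
  exact h

/-- **Equal-time spin fluctuations in the canonical `S^z = 0` ensemble (attractive model,
Falk–Bruch transfer).** For `U < 0`, any `μ`, `β > 0`, a non-empty sector `N↑ = N↓ = k` and every
finite family of real fields `a_j`, with `H_p = H|_p`, `M_j = M_{a_j}|_p`, `B = Σ_j Σₓ a_{j,x}²`: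
`Σ_j ⟨M_j²⟩_{β,H_p} ≤ B/(β|U|) + ½ √((B/|U|) · Σ_j ⟨[M_j,[H_p,M_j]]⟩_{β,H_p})`; the double
commutator is the block kinetic form `(t·T((aₓ-a_y)²))|_p` (`spinDensityField_doubleComm_toBlock_eq`).
Kubo–Kishi's (4) / Remark 1 canonically. [cite: KuboKishi1990, Remark 1, eq. (4)] -/
theorem hubbard_attractive_sector_falkBruch_le {t U μ β : ℝ} (hU : U < 0) (hβ : 0 < β) {k : ℕ}
    (p : Finset (Orb Λ) → Prop) [DecidablePred p]
    (hp : ∀ s, p s ↔ (upPart s).card = k ∧ (downPart s).card = k) [Nonempty {s // p s}]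
    {ι : Type*} [Fintype ι] (a : ι → Λ → ℝ) :
    ∑ j, (gibbsState β ((hamiltonianWith G t U μ).toBlock p p)
        ((spinDensityField (a j)).toBlock p p * (spinDensityField (a j)).toBlock p p)).re ≤
      (∑ j, ∑ x, a j x ^ 2) / |U| / β +
        1 / 2 * Real.sqrt ((∑ j, ∑ x, a j x ^ 2) / |U| *
          ∑ j, (gibbsState β ((hamiltonianWith G t U μ).toBlock p p)
            ((spinDensityField (a j)).toBlock p p *
                ((hamiltonianWith G t U μ).toBlock p p * (spinDensityField (a j)).toBlock p p -
                  (spinDensityField (a j)).toBlock p p * (hamiltonianWith G t U μ).toBlock p p) -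
              ((hamiltonianWith G t U μ).toBlock p p * (spinDensityField (a j)).toBlock p p -
                  (spinDensityField (a j)).toBlock p p * (hamiltonianWith G t U μ).toBlock p p) *
                (spinDensityField (a j)).toBlock p p)).re) := by
  have hb : ∑ j, (duhamel β ((hamiltonianWith G t U μ).toBlock p p)
      ((spinDensityField (a j)).toBlock p p) ((spinDensityField (a j)).toBlock p p)).re ≤
      (∑ j, ∑ x, a j x ^ 2) / |U| / β := by
    rw [Finset.sum_div, Finset.sum_div]
    exact sum_le_sum fun j _ => hubbard_attractive_sector_duhamel_le G hU hβ (a j) p hp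
  have h := falkBruch_sum_le_of_le ((isHermitian_hamiltonianWith G t U μ).submatrix _) hβ.le
    (A := fun j => (spinDensityField (a j)).toBlock p p)
    (fun j => (isHermitian_spinDensityField (a j)).submatrix _) hb
  have hβb : β * ((∑ j, ∑ x, a j x ^ 2) / |U| / β) = (∑ j, ∑ x, a j x ^ 2) / |U| := by
    field_simp
  rw [hβb] at h
  exact h

/-- **The block `f`-sum identity for the spin field**: in every sector,
`M_p (H_p M_p - M_p H_p) - (H_p M_p - M_p H_p) M_p = (t · T((aₓ - a_y)²))|_p`, the compression of
`[M_a,[H,M_a]] = t Σ_{x∼y,σ} (aₓ-a_y)² c†_{xσ}c_{yσ}` (all three operators preserve the sectors).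
[cite: KuboKishi1990, Remark 1, eq. (4)] -/
theorem spinDensityField_doubleComm_toBlock_eq (a : Λ → ℝ) (t U μ : ℝ) {k l : ℕ}
    (p : Finset (Orb Λ) → Prop) [DecidablePred p]
    (hp : ∀ s, p s ↔ (upPart s).card = k ∧ (downPart s).card = l) :
    (spinDensityField a).toBlock p p *
        ((hamiltonianWith G t U μ).toBlock p p * (spinDensityField a).toBlock p p -
          (spinDensityField a).toBlock p p * (hamiltonianWith G t U μ).toBlock p p) -
      ((hamiltonianWith G t U μ).toBlock p p * (spinDensityField a).toBlock p p -
          (spinDensityField a).toBlock p p * (hamiltonianWith G t U μ).toBlock p p) *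
        (spinDensityField a).toBlock p p =
      ((t : ℂ) • hoppingForm G fun x y => (a x - a y) ^ 2).toBlock p p := by
  have hPM := preservesSectors_spinDensityField a
  have hPH := preservesSectors_hamiltonianWith G t U μ
  have hM := toBlock_compl_eq_zero_of_preservesSectors hPM p hp
  have hH := toBlock_compl_eq_zero_of_preservesSectors hPH p hp
  have hC := toBlock_compl_eq_zero_of_preservesSectors
    (preservesSectors_sub (hPH.mul hPM) (hPM.mul hPH)) p hp
  rw [← spinDensityField_doubleComm_eq G a t U μ, toBlock_sub_self',
    toBlock_mul_of_offBlock_eq_zero _ _ p hM, toBlock_mul_of_offBlock_eq_zero _ _ p hC,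
    toBlock_sub_self', toBlock_mul_of_offBlock_eq_zero _ _ p hH,
    toBlock_mul_of_offBlock_eq_zero _ _ p hM]

/-! #### Repulsive `U > 0`, bipartite, half filling: every sector `(k,l)`, `k + l = |Λ|` -/

/-- **The Shiba image of a half-filled sector partition function with a charge field.** For a
bipartite sign `ε`, `k + l = |Λ|`, every real field `b` and constant `c`:
`Tr[P_{k,l} e^{-β(H(t,U) - D_b + c)}] = e^{-βUk} Tr[P_{k,k} e^{-β(H(t,-U) - M_b + c)}]`
— `S = orbitalPhase g · W_{D↓}` (`g(x↓) = εₓ`) maps `P_{k,l} ↦ P_{k,k}`, `H(t,U) ↦ H(t,-U) + U N↑`,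
`D_b ↦ M_b`, and `U N↑ = Uk` on the sector `(k,k)`. [cite: KuboKishi1990, proof of Theorem 2]
[cite: LiebPRL1989, proof of Theorem 2] -/
theorem shibaKK_sector_trace_eq (ε : Λ → ℤˣ) (hε : ∀ x y, G.Adj x y → ε x = -ε y) (t U β : ℝ)
    (b : Λ → ℝ) (c : ℝ) {k l : ℕ} (hkl : k + l = Fintype.card Λ) :
    (spinSectorProj k l * gibbsWeight β (hamiltonian G t U - chargeDensityField b +
        (c : ℂ) • (1 : Matrix (Finset (Orb Λ)) (Finset (Orb Λ)) ℂ))).trace =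
      (Real.exp (-(β * (U * k))) : ℂ) *
        (spinSectorProj k k * gibbsWeight β (hamiltonianWith G t (-U) 0 - spinDensityField b +
          (c : ℂ) • (1 : Matrix (Finset (Orb Λ)) (Finset (Orb Λ)) ℂ))).trace := by
  -- the bipartite gauge on the down spins (as in `kuboKishi_charge_gaussianDomination_holds`)
  set g : Orb Λ → ℂ := fun i => if (ofLex i).2 = 1 then (((ε (ofLex i).1 : ℤ) : ℝ) : ℂ) else 1
    with hg_def
  have hε1 : ∀ x, (((ε x : ℤ) : ℝ) : ℂ) = 1 ∨ (((ε x : ℤ) : ℝ) : ℂ) = -1 := fun x => by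
    rcases Int.units_eq_one_or (ε x) with h | h <;> simp [h]
  have hg : ∀ i, ‖g i‖ = 1 := by
    intro i
    simp only [hg_def]
    split_ifs with h
    · rcases hε1 (ofLex i).1 with h1 | h1 <;> simp [h1]
    · simp
  have hg0 : ∀ x, g (orb x 0) = 1 := fun x => by simp [hg_def, orb]
  have hg1 : ∀ x y, G.Adj x y → g (orb x 1) * star (g (orb y 1)) = -1 := by
    intro x y hxy
    have h' : (((ε x : ℤ) : ℝ) : ℂ) = -(((ε y : ℤ) : ℝ) : ℂ) := by
      rw [hε x y hxy, Units.val_neg]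
      push_cast
      ring
    have hgx : g (orb x 1) = (((ε x : ℤ) : ℝ) : ℂ) := by simp [hg_def, orb]
    have hgy : g (orb y 1) = (((ε y : ℤ) : ℝ) : ℂ) := by simp [hg_def, orb]
    rw [hgx, hgy, h']
    rcases hε1 y with h1 | h1 <;> simp [h1]
  set S : Matrix (Finset (Orb Λ)) (Finset (Orb Λ)) ℂ :=
    orbitalPhase g * partialParticleHole (spinDownOrbitals : Finset (Orb Λ)) with hS_def
  have hS : S ∈ Matrix.unitaryGroup (Finset (Orb Λ)) ℂ :=
    mul_mem (orbitalPhase_mem_unitary hg) (partialParticleHole_mem_unitaryGroup _)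
  -- the images of the building blocks
  have hH : S * hamiltonian G t U * Sᴴ = hamiltonian G t (-U) + (U : ℂ) • ∑ x : Λ, numberOp x 0 :=
    shibaKK_conj_hamiltonian G hg hg0 hg1 t U
  have hn0 : ∀ x, S * numberOp x 0 * Sᴴ = numberOp x 0 := fun x => shibaKK_conj_numberOp_up hg x
  have hn1 : ∀ x, S * numberOp x 1 * Sᴴ = 1 - numberOp x 1 := fun x =>
    shibaKK_conj_numberOp_down hg x
  have hone : S * 1 * Sᴴ = 1 := by rw [Matrix.mul_one]; exact hS.2
  have hD : S * chargeDensityField b * Sᴴ = spinDensityField b := by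
    rw [chargeDensityField, spinDensityField, Finset.mul_sum, Finset.sum_mul]
    refine Finset.sum_congr rfl fun x _ => ?_
    rw [Matrix.mul_smul, Matrix.smul_mul, Matrix.mul_sub, Matrix.sub_mul, Matrix.mul_add,
      Matrix.add_mul, hn0, hn1, hone]
    congr 1
    abel
  have hX : S * (hamiltonian G t U - chargeDensityField b +
      (c : ℂ) • (1 : Matrix (Finset (Orb Λ)) (Finset (Orb Λ)) ℂ)) * Sᴴ =
      (hamiltonianWith G t (-U) 0 - spinDensityField b +
        (c : ℂ) • (1 : Matrix (Finset (Orb Λ)) (Finset (Orb Λ)) ℂ)) +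
        (U : ℂ) • ∑ x : Λ, numberOp x 0 := by
    rw [Matrix.mul_add, Matrix.add_mul, Matrix.mul_sub, Matrix.sub_mul, Matrix.mul_smul,
      Matrix.smul_mul, hH, hD, hone, hamiltonianWith_zero]
    abel
  have hP : S * spinSectorProj k l * Sᴴ = spinSectorProj k k := by
    have h := shibaKK_conj_spinSectorProj (k := k) hg (show l ≤ Fintype.card Λ by omega)
    rw [show Fintype.card Λ - l = k by omega] at h
    exact h
  -- insert `S`, transport, and read the residual `U N↑` on the image sector `(k,k)`
  rw [← trace_unitary_conj_mul_unitary_conj hS (spinSectorProj k l), ← gibbsWeight_unitary_conj hS,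
    hP, hX]
  have hp : ∀ s : Finset (Orb Λ), (fun s => (upPart s).card = k ∧ (downPart s).card = k) s ↔
      (upPart s).card = k ∧ (downPart s).card = k := fun s => Iff.rfl
  have hY : PreservesSectors (hamiltonianWith G t (-U) 0 - spinDensityField b +
      (c : ℂ) • (1 : Matrix (Finset (Orb Λ)) (Finset (Orb Λ)) ℂ)) :=
    (preservesSectors_sub (preservesSectors_hamiltonianWith G t (-U) 0)
      (preservesSectors_spinDensityField b)).add (preservesSectors_one'.smul _)
  have hN : PreservesSectors ((U : ℂ) • ∑ x : Λ, numberOp x 0 :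
      Matrix (Finset (Orb Λ)) (Finset (Orb Λ)) ℂ) :=
    (PreservesSectors.sum fun x _ => preservesSectors_numberOp x 0).smul _
  rw [trace_spinSectorProj_mul_gibbsWeight (hY.add hN) β _ hp,
    trace_spinSectorProj_mul_gibbsWeight hY β _ hp, toBlock_add_self', toBlock_smul_self',
    sum_numberOp_zero_eq_diagonal,
    toBlock_diagonal_of_const (fun s => (upPart s).card = k ∧ (downPart s).card = k) (r := (k : ℂ))
      (fun s hs => by show ((upPart s).card : ℂ) = k; rw [hs.1]),
    smul_smul, show (U : ℂ) * (k : ℂ) = ((U * k : ℝ) : ℂ) by push_cast; ring,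
    partitionFn_add_smul_one]

/-- **Kubo–Kishi's Gaussian domination in the canonical half-filled ensemble of the repulsive
Hubbard model on a bipartite graph (block form).** For a bipartite sign `ε`, `U > 0`, `β > 0`,
every real field `a` and every sector `N↑ = k`, `N↓ = l` with `k + l = |Λ|` (any `S^z`; presented by
any decidable `p`): `Re Z_β((H(t,U) - D_a + (Σₓaₓ²/(2U))·1)|_p) ≤ Re Z_β(H(t,U)|_p)`,
`D_a = Σₓ aₓ(nₓ - 1)` — the Shiba image (`shibaKK_sector_trace_eq`) of the attractive `S^z = 0`
sector domination at coupling `-U`; the common factor `e^{-βUk}` cancels. (A chemical potential is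
a constant `μ(k+l)` on the sector and changes nothing.) Off half filling the map leaves the
half-filled sectors and no bound is claimed. [cite: KuboKishi1990, proof of Theorem 2, eq. (5)]
[cite: LiebPRL1989, proof of Theorem 2] -/
theorem hubbard_repulsive_halfFilledSector_blockGaussianDomination (ε : Λ → ℤˣ)
    (hε : ∀ x y, G.Adj x y → ε x = -ε y) {t U β : ℝ} (hU : 0 < U) (hβ : 0 < β) (a : Λ → ℝ)
    {k l : ℕ} (hkl : k + l = Fintype.card Λ) (p : Finset (Orb Λ) → Prop) [DecidablePred p]
    (hp : ∀ s, p s ↔ (upPart s).card = k ∧ (downPart s).card = l) :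
    (partitionFn β ((hamiltonian G t U - chargeDensityField a +
        (((∑ x, a x ^ 2) / (2 * U) : ℝ) : ℂ) •
          (1 : Matrix (Finset (Orb Λ)) (Finset (Orb Λ)) ℂ)).toBlock p p)).re ≤
      (partitionFn β ((hamiltonian G t U).toBlock p p)).re := by
  have hH : PreservesSectors (hamiltonian G t U) := preservesSectors_hamiltonian G t U
  have hX : PreservesSectors (hamiltonian G t U - chargeDensityField a +
      (((∑ x, a x ^ 2) / (2 * U) : ℝ) : ℂ) • (1 : Matrix (Finset (Orb Λ)) (Finset (Orb Λ)) ℂ)) :=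
    (preservesSectors_sub hH (preservesSectors_chargeDensityField a)).add (preservesSectors_one'.smul _)
  rw [← trace_spinSectorProj_mul_gibbsWeight hX β p hp, ← trace_spinSectorProj_mul_gibbsWeight hH β p hp]
  have h0 : hamiltonian G t U = hamiltonian G t U - chargeDensityField (fun _ : Λ => (0 : ℝ)) +
      ((0 : ℝ) : ℂ) • (1 : Matrix (Finset (Orb Λ)) (Finset (Orb Λ)) ℂ) := by
    simp [chargeDensityField]
  have h0' : hamiltonianWith G t (-U) 0 - spinDensityField (fun _ : Λ => (0 : ℝ)) +
      ((0 : ℝ) : ℂ) • (1 : Matrix (Finset (Orb Λ)) (Finset (Orb Λ)) ℂ) = hamiltonianWith G t (-U) 0 := by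
    simp [spinDensityField]
  conv_rhs => rw [h0]
  rw [shibaKK_sector_trace_eq G ε hε t U β a _ hkl, shibaKK_sector_trace_eq G ε hε t U β _ _ hkl, h0',
    Complex.re_ofReal_mul, Complex.re_ofReal_mul]
  refine mul_le_mul_of_nonneg_left ?_ (Real.exp_pos _).le
  have h := hubbard_attractive_sectorGaussianDomination G t (-U) 0 β (by linarith) hβ a k k
  rw [abs_neg, abs_of_pos hU] at h
  have hnn : 0 ≤ ((spinSectorProj k k * gibbsWeight β (hamiltonianWith G t (-U) 0)).trace).re :=
    Literature.LinearAlgebra.Matrix.re_trace_mul_nonneg_of_posSemidef (posSemidef_spinSectorProj k k)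
      (posDef_gibbsWeight β (isHermitian_hamiltonianWith G t (-U) 0)).posSemidef
  rwa [Real.mul_self_sqrt hnn] at h

/-- **Kubo–Kishi (5) in the canonical half-filled ensemble (repulsive model, bipartite graph).**
For a bipartite sign, `U > 0`, `β > 0`, every real `a` and every non-empty sector `(k,l)` with
`k + l = |Λ|`: `(D_a|_p, D_a|_p)_{β, H(t,U)|_p} ≤ Σₓ aₓ²/(βU)`, `D_a = Σₓ aₓ(nₓ - 1)` (`= Σ aₓ δnₓ`
at half filling); by the pseudospin rotation it is also the canonical on-site pairing bound (their
(6)). Dyson–Lieb–Simon's lemma fed with the block Gaussian domination along `τ ↦ D_{τa}`.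
[cite: KuboKishi1990, Theorem 2, eqs. (5), (6)] [cite: DLS1978, Lemma 4.1, eq. (44)] -/
theorem hubbard_repulsive_halfFilledSector_duhamel_le (ε : Λ → ℤˣ)
    (hε : ∀ x y, G.Adj x y → ε x = -ε y) {t U β : ℝ} (hU : 0 < U) (hβ : 0 < β) (a : Λ → ℝ)
    {k l : ℕ} (hkl : k + l = Fintype.card Λ) (p : Finset (Orb Λ) → Prop) [DecidablePred p]
    (hp : ∀ s, p s ↔ (upPart s).card = k ∧ (downPart s).card = l) [Nonempty {s // p s}] :
    (duhamel β ((hamiltonian G t U).toBlock p p) ((chargeDensityField a).toBlock p p)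
        ((chargeDensityField a).toBlock p p)).re ≤ (∑ x, a x ^ 2) / U / β := by
  refine gaussianDomination_duhamel_le_holds {s // p s} β hβ _ _
    ((hamiltonian_isHermitian G t U).submatrix _) ((isHermitian_chargeDensityField a).submatrix _)
    _ fun τ => ?_
  have h := hubbard_repulsive_halfFilledSector_blockGaussianDomination G ε hε (t := t) hU hβ
    (fun x => τ * a x) hkl p hp
  have hc : (∑ x, (τ * a x) ^ 2) / (2 * U) = τ ^ 2 * ((∑ x, a x ^ 2) / U) / 2 := by
    rw [sum_sq_mul']; ring
  rw [chargeDensityField_smul', hc, toBlock_sub_smul_add_smul_one] at h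
  exact h

/-- **Equal-time charge fluctuations in the canonical half-filled ensemble (repulsive model,
bipartite graph, Falk–Bruch transfer).** For a bipartite sign, `U > 0`, `β > 0`, a non-empty sector
`(k,l)` with `k + l = |Λ|` and every finite family of real fields `a_j`, with `H_p = H(t,U)|_p`,
`D_j = D_{a_j}|_p`, `B = Σ_j Σₓ a_{j,x}²`:
`Σ_j ⟨D_j²⟩_{β,H_p} ≤ B/(βU) + ½ √((B/U) · Σ_j ⟨[D_j,[H_p,D_j]]⟩_{β,H_p})`; the double commutator is
the block kinetic form `(t·T((aₓ-a_y)²))|_p` (`chargeDensityField_doubleComm_toBlock_eq`), so with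
staggered / density-wave profiles this is a CDW (and, by pseudospin symmetry, on-site pairing)
structure-factor ceiling in every half-filled sector. Kubo–Kishi's Remark 3 canonically.
[cite: KuboKishi1990, Theorem 2 and Remark 3] -/
theorem hubbard_repulsive_halfFilledSector_falkBruch_le (ε : Λ → ℤˣ)
    (hε : ∀ x y, G.Adj x y → ε x = -ε y) {t U β : ℝ} (hU : 0 < U) (hβ : 0 < β) {k l : ℕ}
    (hkl : k + l = Fintype.card Λ) (p : Finset (Orb Λ) → Prop) [DecidablePred p]
    (hp : ∀ s, p s ↔ (upPart s).card = k ∧ (downPart s).card = l) [Nonempty {s // p s}]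
    {ι : Type*} [Fintype ι] (a : ι → Λ → ℝ) :
    ∑ j, (gibbsState β ((hamiltonian G t U).toBlock p p)
        ((chargeDensityField (a j)).toBlock p p * (chargeDensityField (a j)).toBlock p p)).re ≤
      (∑ j, ∑ x, a j x ^ 2) / U / β +
        1 / 2 * Real.sqrt ((∑ j, ∑ x, a j x ^ 2) / U *
          ∑ j, (gibbsState β ((hamiltonian G t U).toBlock p p)
            ((chargeDensityField (a j)).toBlock p p *
                ((hamiltonian G t U).toBlock p p * (chargeDensityField (a j)).toBlock p p -
                  (chargeDensityField (a j)).toBlock p p * (hamiltonian G t U).toBlock p p) -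
              ((hamiltonian G t U).toBlock p p * (chargeDensityField (a j)).toBlock p p -
                  (chargeDensityField (a j)).toBlock p p * (hamiltonian G t U).toBlock p p) *
                (chargeDensityField (a j)).toBlock p p)).re) := by
  have hb : ∑ j, (duhamel β ((hamiltonian G t U).toBlock p p)
      ((chargeDensityField (a j)).toBlock p p) ((chargeDensityField (a j)).toBlock p p)).re ≤
      (∑ j, ∑ x, a j x ^ 2) / U / β := by
    rw [Finset.sum_div, Finset.sum_div]
    exact sum_le_sum fun j _ =>
      hubbard_repulsive_halfFilledSector_duhamel_le G ε hε hU hβ (a j) hkl p hp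
  have h := falkBruch_sum_le_of_le ((hamiltonian_isHermitian G t U).submatrix _) hβ.le
    (A := fun j => (chargeDensityField (a j)).toBlock p p)
    (fun j => (isHermitian_chargeDensityField (a j)).submatrix _) hb
  have hβb : β * ((∑ j, ∑ x, a j x ^ 2) / U / β) = (∑ j, ∑ x, a j x ^ 2) / U := by
    field_simp
  rw [hβb] at h
  exact h

/-- **The block `f`-sum identity for the charge field**: in every sector,
`D_p (H_p D_p - D_p H_p) - (H_p D_p - D_p H_p) D_p = (t · T((aₓ - a_y)²))|_p` for `H = H(t,U)`
(the constant in `D_a` drops out of every commutator). [cite: KuboKishi1990, Theorem 2 and Remark 3] -/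
theorem chargeDensityField_doubleComm_toBlock_eq (a : Λ → ℝ) (t U : ℝ) {k l : ℕ}
    (p : Finset (Orb Λ) → Prop) [DecidablePred p]
    (hp : ∀ s, p s ↔ (upPart s).card = k ∧ (downPart s).card = l) :
    (chargeDensityField a).toBlock p p *
        ((hamiltonian G t U).toBlock p p * (chargeDensityField a).toBlock p p -
          (chargeDensityField a).toBlock p p * (hamiltonian G t U).toBlock p p) -
      ((hamiltonian G t U).toBlock p p * (chargeDensityField a).toBlock p p -
          (chargeDensityField a).toBlock p p * (hamiltonian G t U).toBlock p p) *
        (chargeDensityField a).toBlock p p =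
      ((t : ℂ) • hoppingForm G fun x y => (a x - a y) ^ 2).toBlock p p := by
  have hPM := preservesSectors_chargeDensityField a
  have hPH : PreservesSectors (hamiltonian G t U) := preservesSectors_hamiltonian G t U
  have hM := toBlock_compl_eq_zero_of_preservesSectors hPM p hp
  have hH := toBlock_compl_eq_zero_of_preservesSectors hPH p hp
  have hC := toBlock_compl_eq_zero_of_preservesSectors
    (preservesSectors_sub (hPH.mul hPM) (hPM.mul hPH)) p hp
  have hfs := chargeDensityField_doubleComm_eq G a t U 0
  rw [hamiltonianWith_zero] at hfs
  rw [← hfs, toBlock_sub_self',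
    toBlock_mul_of_offBlock_eq_zero _ _ p hM, toBlock_mul_of_offBlock_eq_zero _ _ p hC,
    toBlock_sub_self', toBlock_mul_of_offBlock_eq_zero _ _ p hH,
    toBlock_mul_of_offBlock_eq_zero _ _ p hM]

end Canonical

end Literature.MathematicalPhysics.QuantumLattice

end
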